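import Literature.Analysis.FluidPDE.PeriodicCylinderNeumannTangential
import Literature.Analysis.FluidPDE.PeriodicCylinderCellC1Half
import Literature.Analysis.FunctionSpaces.SobolevTracePoincareProofs
import HarnessLib

/-!
# The base estimate of the Neumann problem on the period cell: `‖∇q‖_{L²}` by the data

Topic `Literature/Analysis/FluidPDE`. Support file (all results proved, no named facts, no
definitions) for the discharge of the pressure estimate
`Literature.Analysis.FluidPDE.Ferrari1993_periodicCylinderPressureEstimate`
(`Ferrari1993EnergyInequalityReduction.lean`; A. B. Ferrari, Comm. Math. Phys. **155** (1993),
Lemma 2 pp. 280–281: the standard `H^s` estimate of `∇p` from the Neumann problem (10)–(12)),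
complementing the tangential estimate of `PeriodicCylinderNeumannTangential.lean`. That file
bounds `‖∇ Z^β q‖_{L²(cell)}` for every **nonempty** tangential word `β`; the zeroth level — the
gradient itself — needs in addition the Poincaré–Wirtinger inequality on the cell (the Neumann
problem determines `q` up to constants only, and the data control `∇q` through `q − ⨍q`):

* `exists_cellL2_cylGrad_le_of_neumann` — for `L > 0` there is `C` such that for all `q`, `G`
  smooth on the closed cylinder `{r ≤ 1}` and `L`-periodic in `z`, with the Neumann relation
  `∂_{x_h} q = G` on the wall `{r = 1}` (`∂_{x_h} = r∂_r`),
  `‖∇q‖_{L²(cell)} ≤ C (‖Δq‖_{L²(cell)} + ‖∇G‖_{L²(cell)} + ‖G‖_{L²(cell)})`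
  (sizes `cellL2`, derivatives within the closed cylinder: `cylGrad`, `cylLap`).

Proof: the energy identity of the Neumann problem
(`setIntegral_norm_cylGrad_sq_eq`: `∫‖∇q‖² = ∫G∂_{x_h}q − ∫qΔq + ∫q∂_{x_h}G + 2∫qG`) applied to
`q − ⨍_cell q`, which has the same gradient, Laplacian and Neumann datum; Cauchy–Schwarz with
`|∂_{x_h}f| ≤ ‖∇f‖` on the closed cylinder; and the Poincaré inequality
`‖q − ⨍q‖_{L²(cell)} ≤ C_P ‖∇q‖_{L²(cell)}` on the bounded convex cell, star-shaped with respect to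
the ball `B((L/2)e_z, min(1, L/2))` it contains (the tree's `poincare_starShaped`, Maz'ya §1.1.11;
classical derivatives are weak derivatives on the open cell, `MeyersSerrin.hasWeakFDerivOn_of_contDiffOn`).
The constant is `1 + 2C_P`. Folklore (the coercivity of the Neumann problem modulo constants,
Taylor *PDE I* Ch. 5 §7 (7.5)/(7.14)).

Mathlib/tree search: Poincaré inequalities in the tree: `poincare_starShaped`,
`poincare_wirtinger_holds` (`SobolevTracePoincareProofs`), `lintegral_enorm_sub_setAverage_sq_le`
(`PoincareWirtingerConvex`); cell geometry `isBounded_cylinderCell`, `convex_cylinderCell`,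
`ball_subset_cylinderCell`; no gradient bound for the Neumann problem on the cell
(`lean search 'cylGrad_le|neumann.*grad'`). From Mathlib: `fderivWithin_sub_const`,
`eLpNorm_congr_norm_ae`, `Convex.starConvex`.
-/

noncomputable section

open MeasureTheory Set Function Filter Topology TopologicalSpace WithLp Metric
open scoped ContDiff NNReal ENNReal InnerProductSpace RealInnerProductSpace

namespace Literature.Analysis.FluidPDE

open Literature.Analysis.FunctionSpaces

/-- Local notation for physical space `ℝ³ = EuclideanSpace ℝ (Fin 3)`. -/
local notation "ℝ³" => EuclideanSpace ℝ (Fin 3)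

/-- Local notation for the closed unit cylinder `{r ≤ 1}`. -/
local notation "𝕂" => closure (SetLike.coe unitCylinder : Set (EuclideanSpace ℝ (Fin 3)))

/-! ### Subtracting a constant -/

/-- Derivatives within the closed cylinder do not see additive constants. [folklore] -/
theorem cylDeriv_sub_const (V : ℝ³ → ℝ³) (f : ℝ³ → ℝ) (c : ℝ) :
    cylDeriv V (fun y => f y - c) = cylDeriv V f := by
  funext x
  simp only [cylDeriv_apply, fderivWithin_sub_const]

/-- The gradient within does not see additive constants. [folklore] -/
theorem cylGrad_sub_const (f : ℝ³ → ℝ) (c : ℝ) : cylGrad (fun y => f y - c) = cylGrad f := by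
  funext x
  simp only [cylGrad_apply, cylDeriv_sub_const]

/-- The Laplacian within does not see additive constants. [folklore] -/
theorem cylLap_sub_const (f : ℝ³ → ℝ) (c : ℝ) : cylLap (fun y => f y - c) = cylLap f := by
  funext x
  simp only [cylLap_apply, cylDeriv_sub_const]

/-! ### The Poincaré inequality on the cell, for the gradient within -/

/-- **Poincaré–Wirtinger on the period cell for functions smooth on the closed cylinder**: for
`L > 0` there is `C_P` such that `‖f − ⨍_cell f‖_{L²(cell)} ≤ C_P ‖∇_K f‖_{L²(cell)}` (sizes
`cellL2`) for every real `f` of class `C^∞` on `{r ≤ 1}` — the tree's `poincare_starShaped` on the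
bounded convex cell, which contains the ball `B((L/2)e_z, min(1, L/2))`, the classical derivative
being a weak derivative on the open cell and `‖Df(x)‖ = ‖∇_K f(x)‖` there. [folklore] -/
theorem exists_cellL2_sub_average_le {L : ℝ} (hL : 0 < L) :
    ∃ C : ℝ, 0 ≤ C ∧ ∀ (f : ℝ³ → ℝ), ContDiffOn ℝ ∞ f 𝕂 →
      cellL2 L (fun x => f x - ⨍ y in (cylinderCell L : Set ℝ³), f y) ≤ C * cellL2 L (cylGrad f) := by
  set a : ℝ³ := (L / 2) • EuclideanSpace.single (2 : Fin 3) (1 : ℝ) with ha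
  have hr : 0 < min 1 (L / 2) := lt_min one_pos (half_pos hL)
  have hball : ball a (min 1 (L / 2)) ⊆ (cylinderCell L : Set ℝ³) := ball_subset_cylinderCell L
  have hstar : ∀ y ∈ ball a (min 1 (L / 2)), StarConvex ℝ y (cylinderCell L : Set ℝ³) :=
    fun y hy => (convex_cylinderCell L).starConvex (hball hy)
  obtain ⟨CP, hCPtop, hCP⟩ := poincare_starShaped (μ := volume) (F := ℝ) (U := cylinderCell L)
    (isBounded_cylinderCell L) hr hball hstar (p := 2) (by norm_num)
  refine ⟨CP.toReal, ENNReal.toReal_nonneg, fun f hf => ?_⟩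
  set Ω : Set ℝ³ := (cylinderCell L : Set ℝ³) with hΩ
  set μ : Measure ℝ³ := volume.restrict Ω with hμ
  have hΩU : Ω ⊆ (unitCylinder : Set ℝ³) := cylinderCell_le_unitCylinder L
  have hΩm : MeasurableSet Ω := (cylinderCell L).isOpen.measurableSet
  have hfΩ : ContDiffOn ℝ ∞ f (cylinderCell L) := hf.mono (subset_closure.trans (closure_cylinderCell_subset L))
  have hmem : MemLp f 2 μ := memLp_two_cylinderCell_of_continuousOn L hf.continuousOn
  have hW := MeyersSerrin.hasWeakFDerivOn_of_contDiffOn (μ := volume) hfΩ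
  have key := hCP f (fderiv ℝ f) hmem hW
  -- `‖Df(x)‖ = ‖∇_K f(x)‖` on the cell
  have hnorm : eLpNorm (fderiv ℝ f) 2 μ = eLpNorm (cylGrad f) 2 μ := by
    refine eLpNorm_congr_norm_ae (ae_restrict_of_forall_mem hΩm fun x hx => ?_)
    rw [norm_cylGrad, fderivWithin_of_mem_nhds (closure_unitCylinder_mem_nhds (hΩU hx))]
  rw [hnorm] at key
  have hgrad_fin : eLpNorm (cylGrad f) 2 μ ≠ ⊤ :=
    (memLp_two_cylinderCell_of_continuousOn L (contDiffOn_cylGrad hf).continuousOn).eLpNorm_ne_top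
  have hfin : CP * eLpNorm (cylGrad f) 2 μ ≠ ⊤ := ENNReal.mul_ne_top hCPtop hgrad_fin
  have h := ENNReal.toReal_mono hfin key
  rw [ENNReal.toReal_mul] at h
  exact h

/-! ### The base estimate -/

/-- **`‖∇q‖_{L²(cell)}` by the data of the Neumann problem.** For `L > 0` there is `C` such that
for all real `q`, `G` of class `C^∞` on the closed cylinder `{r ≤ 1}`, `L`-periodic in `z`, with
`∂_{x_h} q = G` on the wall `{r = 1}`,
`‖∇q‖_{L²(cell)} ≤ C (‖Δq‖_{L²(cell)} + ‖∇G‖_{L²(cell)} + ‖G‖_{L²(cell)})`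
(sizes `cellL2`; `cylGrad`, `cylLap` the gradient and Laplacian within the closed cylinder). Proof:
the energy identity `setIntegral_norm_cylGrad_sq_eq` for `q − ⨍_cell q` (same gradient, Laplacian
and Neumann datum), Cauchy–Schwarz, `|∂_{x_h} f| ≤ ‖∇f‖`, and Poincaré–Wirtinger
(`exists_cellL2_sub_average_le`); `C = 1 + 2 C_P`. This is the zeroth (Poincaré) level of the
`H^s` estimate of the Neumann problem (10)–(12) of Ferrari 1993, p. 281 (coercivity modulo
constants: Taylor, *PDE I*, Ch. 5 §7). [cite: Ferrari1993, Lemma 2 pp. 280–281 (the H^s estimate of ∇p: level zero)] -/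
theorem exists_cellL2_cylGrad_le_of_neumann {L : ℝ} (hL : 0 < L) :
    ∃ C : ℝ, 0 ≤ C ∧ ∀ (q G : ℝ³ → ℝ), ContDiffOn ℝ ∞ q 𝕂 → ContDiffOn ℝ ∞ G 𝕂 →
      IsAxiallyPeriodic L q → IsAxiallyPeriodic L G →
      (∀ x ∈ frontier (unitCylinder : Set ℝ³), cylDeriv (fun y => horizontalProj y) q x = G x) →
      cellL2 L (cylGrad q) ≤ C * (cellL2 L (cylLap q) + cellL2 L (cylGrad G) + cellL2 L G) := by
  obtain ⟨cP, hcP0, hcP⟩ := exists_cellL2_sub_average_le hL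
  refine ⟨1 + 2 * cP, by positivity, fun q G hq hG hqp hGp hN => ?_⟩
  set Ω : Set ℝ³ := (cylinderCell L : Set ℝ³) with hΩ
  -- the mean-free representative
  set m : ℝ := ⨍ y in (cylinderCell L : Set ℝ³), q y with hm
  set q' : ℝ³ → ℝ := fun y => q y - m with hq'_def
  have hq' : ContDiffOn ℝ ∞ q' 𝕂 := hq.sub contDiffOn_const
  have hq'p : IsAxiallyPeriodic L q' := fun x => by simp only [hq'_def, hqp x]
  have hgrad : cylGrad q' = cylGrad q := cylGrad_sub_const q m
  have hlap : cylLap q' = cylLap q := cylLap_sub_const q m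
  have hR : cylDeriv (fun y => horizontalProj y) q' = cylDeriv (fun y => horizontalProj y) q :=
    cylDeriv_sub_const _ q m
  have hN' : ∀ x ∈ frontier (unitCylinder : Set ℝ³), cylDeriv (fun y => horizontalProj y) q' x = G x := by
    intro x hx; rw [hR]; exact hN x hx
  -- the energy identity
  have hE := setIntegral_norm_cylGrad_sq_eq hL hq' hG hq'p hGp hN'
  rw [hgrad, hlap, hR] at hE
  -- continuity facts
  have hKΩ : ∀ {x : ℝ³}, x ∈ Ω → x ∈ 𝕂 := fun hx => subset_closure (cylinderCell_le_unitCylinder L hx)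
  have cq' : ContinuousOn q' 𝕂 := hq'.continuousOn
  have cG : ContinuousOn G 𝕂 := hG.continuousOn
  have cgr : ContinuousOn (cylGrad q) 𝕂 := (contDiffOn_cylGrad hq).continuousOn
  have cgrG : ContinuousOn (cylGrad G) 𝕂 := (contDiffOn_cylGrad hG).continuousOn
  have cRq : ContinuousOn (cylDeriv (fun y => horizontalProj y) q) 𝕂 :=
    (contDiffOn_cylDeriv contDiff_horizontalProj hq).continuousOn
  have cRG : ContinuousOn (cylDeriv (fun y => horizontalProj y) G) 𝕂 :=
    (contDiffOn_cylDeriv contDiff_horizontalProj hG).continuousOn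
  have cL : ContinuousOn (cylLap q) 𝕂 := (contDiffOn_cylLap hq).continuousOn
  -- the sizes
  set a : ℝ := cellL2 L (cylGrad q) with ha_def
  have ha0 : 0 ≤ a := cellL2_nonneg L _
  have hsq : ∫ x in Ω, ‖cylGrad q x‖ ^ 2 = a ^ 2 := integral_norm_sq_eq_cellL2_sq L cgr
  set nq : ℝ := cellL2 L q' with hnq_def
  have hnq0 : 0 ≤ nq := cellL2_nonneg L _
  -- Poincaré
  have hP : nq ≤ cP * a := by
    have h := hcP q hq
    rw [ha_def]
    exact h
  -- the four terms
  have T1 : |∫ x in Ω, G x * cylDeriv (fun y => horizontalProj y) q x| ≤ a * cellL2 L G := by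
    have e : ∫ x in Ω, G x * cylDeriv (fun y => horizontalProj y) q x =
        ∫ x in Ω, cylDeriv (fun y => horizontalProj y) q x * G x :=
      integral_congr_ae (Eventually.of_forall fun x => mul_comm _ _)
    rw [e]
    exact abs_setIntegral_mul_le_cellL2_of_le L cRq cG cgr fun x hx =>
      abs_cylDeriv_horizontalProj_le q (hKΩ hx)
  have T2 : |∫ x in Ω, q' x * cylLap q x| ≤ nq * cellL2 L (cylLap q) :=
    abs_setIntegral_mul_le_cellL2 L cq' cL
  have T3 : |∫ x in Ω, q' x * cylDeriv (fun y => horizontalProj y) G x| ≤ nq * cellL2 L (cylGrad G) := by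
    have e : ∫ x in Ω, q' x * cylDeriv (fun y => horizontalProj y) G x =
        ∫ x in Ω, cylDeriv (fun y => horizontalProj y) G x * q' x :=
      integral_congr_ae (Eventually.of_forall fun x => mul_comm _ _)
    rw [e, mul_comm]
    exact abs_setIntegral_mul_le_cellL2_of_le L cRG cq' cgrG fun x hx =>
      abs_cylDeriv_horizontalProj_le G (hKΩ hx)
  have T4 : |∫ x in Ω, q' x * G x| ≤ nq * cellL2 L G := abs_setIntegral_mul_le_cellL2 L cq' cG
  -- assemble `a² ≤ a R`
  set R : ℝ := cellL2 L G + cP * (cellL2 L (cylLap q) + cellL2 L (cylGrad G) + 2 * cellL2 L G) with hR_def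
  have hG0 : 0 ≤ cellL2 L G := cellL2_nonneg L _
  have hL0 : 0 ≤ cellL2 L (cylLap q) := cellL2_nonneg L _
  have hgG0 : 0 ≤ cellL2 L (cylGrad G) := cellL2_nonneg L _
  have hR0 : 0 ≤ R := by positivity
  have key : a ^ 2 ≤ a * R := by
    rw [← hsq, hE]
    have h1 := le_abs_self (∫ x in Ω, G x * cylDeriv (fun y => horizontalProj y) q x)
    have h2 := neg_abs_le (∫ x in Ω, q' x * cylLap q x)
    have h3 := le_abs_self (∫ x in Ω, q' x * cylDeriv (fun y => horizontalProj y) G x)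
    have h4 := le_abs_self (∫ x in Ω, q' x * G x)
    have hb : nq * (cellL2 L (cylLap q) + cellL2 L (cylGrad G) + 2 * cellL2 L G) ≤
        cP * a * (cellL2 L (cylLap q) + cellL2 L (cylGrad G) + 2 * cellL2 L G) :=
      mul_le_mul_of_nonneg_right hP (by positivity)
    rw [hR_def]
    nlinarith [T1, T2, T3, T4, hb, ha0, hnq0, hG0, hL0, hgG0]
  have haR : a ≤ R := by
    by_cases ha' : a = 0
    · rw [ha']; exact hR0
    · have hapos : 0 < a := lt_of_le_of_ne ha0 (Ne.symm ha')
      nlinarith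
  calc a ≤ R := haR
    _ ≤ (1 + 2 * cP) * (cellL2 L (cylLap q) + cellL2 L (cylGrad G) + cellL2 L G) := by
        rw [hR_def]
        nlinarith [hG0, hL0, hgG0, hcP0]

end Literature.Analysis.FluidPDE
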